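import Summits.BirchSwinnertonDyer.BirchSwinnertonDyer.Theses.GenusKolyvaginAtTwo

/-!
# Route `GenusKolyvaginAtTwo`, item stmt-BirchSwinnertonDyer-22137 `KolyvaginExactAtTwo` (X, aside since rev 26):
# the REGISTERED skeleton's composition in the tree — X BY NAME from its two registered stubs
# (bookkeeping helper; seat `leafhand-bsd-genuskolyvaginattw-2` g0)

The registered skeleton of X (`work/KolyvaginExactAtTwo.lean`, sha `1a958fc91c330b42…`, seat gk2-p2 g2;
originally `birth_22137.lean`, planner bsd-idea-1 g0) splits McCallum's exact-order statement at `p = 2`,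
`#Ш(E_K/K)[2^∞] = 2^{2M₀}`, into the two divisibilities:

* `stub_upperBoundAtTwo` — `2^{M₀+1} ∤ y_K` in `E(K[1])` ⟹ `#Ш(E_K)[2^∞] ∣ 2^{2M₀}` (Kolyvagin's upper bound
  at `2` over `K`, sharp exponent, no Kolyvagin-prime certificate, no Manin/Tamagawa correction);
* `stub_lowerBoundAtTwo` — `2^{M₀} ∣ y_K` in `E(K[1])` and an indivisible derived point `P(n) ∉ 2E(K[n])`
  at a square-free product of Zhang–Kolyvagin primes at `2` ⟹ `2^{2M₀} ∣ #Ш(E_K)[2^∞]`.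

This file records ONLY the composition `kolyvaginExactAtTwo_of_stubs` (`Nat.dvd_antisymm`), registered
signatures VERBATIM, so that the ledger's «X closed modulo its registered stubs» has a tree witness (as
`MultiGenusPrimitivityAtTwo.multiGenusPrimitivityAtTwo_of_stubPositiveDepth` does for 24947 and
`GenusExact.KolyvaginRelationAtTwoStubs.kolyvaginRelationAtTwo_of_stubs` for 24880). The converse projections
do NOT hold (X needs both `M₀`-hypotheses and a certificate; neither stub is a conjunct of X) and are not claimed.

STANDING CAVEATS (ledger verdict notes, not re-derived here): seat gk2-p2 g2/g3 — X AS TYPED (both signs of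
`Δ_E`, `2` split or inert in `K`, certificate primes in Zhang's congruence form) is «misstated (scope)»; the
consistent restatement is `Restate.C3` (`W.Δ < 0`, `2` split in `K`, `FrobEqFrobInfty` conjunct), and the
route's live re-typing is the odd-Tamagawa cut `ShaCardDvdPowAtTwoRT` (23469, PROVED modulo Q2) /
`PowDvdShaCardAtTwoRT` (23659, PROVED). Both registered stubs are beyond print at `2` and OPEN; nothing here
closes either. BSD is not proved by any of this. References: [McCallumLMS1991] Thm. 5.4 / §5;
[GrossLMS1991] §4; [KolyvaginEulerSystems1990] Thm. A.
-/

set_option autoImplicit false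
set_option linter.dupNamespace false -- tree convention: `Summit.BirchSwinnertonDyer.BirchSwinnertonDyer.Theorems`

namespace Summit.BirchSwinnertonDyer.BirchSwinnertonDyer.Theorems.GenusExact.KolyvaginExactAtTwoStubs

open Summit.BirchSwinnertonDyer.BirchSwinnertonDyer.Theses.GenusKolyvaginAtTwo
open Literature.NumberTheory.EllipticCurves Literature.NumberTheory.EllipticCurves.ModularForms

/-- **X `KolyvaginExactAtTwo` BY NAME from its two REGISTERED stubs** (skeleton sha `1a958fc91c33…`, signatures
verbatim): under X's binders the upper stub gives `#Ш ∣ 2^{2M₀}` from `2^{M₀+1} ∤ y_K`, the lower stub gives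
`2^{2M₀} ∣ #Ш` from `2^{M₀} ∣ y_K` and the certificate, and `Nat.dvd_antisymm` concludes.
[cite: McCallumLMS1991, Thm. 5.4 (structure of Ш(E/K)[p^∞])] -/
theorem kolyvaginExactAtTwo_of_stubs
    (hU : ∀ (W : WeierstrassCurve ℚ) [W.IsElliptic] [W.IsGloballyMinimal] [NeZero (W.conductorNorm ℤ)], ¬ W.HasCM → ∀ (K : Type) [Field K] [NumberField K], IsImaginaryQuadratic K → Odd (NumberField.discr K) → NumberField.discr K ≠ -3 → SatisfiesHeegnerHypothesis (W.conductorNorm ℤ) K → ¬ IsSquare ((NumberField.discr K : ℚ) * -|W.Δ|) → ¬ IsSquare ((NumberField.discr K : ℚ) * (-(2 * |W.Δ|))) → (∀ n : ℕ, 0 < n → W.HasSurjectiveModNGaloisRep ((2 : ℤ) ^ n)) → ∀ (Dt : ModularParametrizationData W (W.conductorNorm ℤ)) (β : ℤ) (ι : K →+* ℂ) (d₁ : KolyvaginHeegnerData Dt β ι 1), ¬ IsOfFinAddOrder d₁.derivedPoint → ∀ (M₀ : ℕ), (¬ ∃ Q : (W.baseChange (ringClassField K ι 1)).toAffine.Point,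 ((2 ^ (M₀ + 1) : ℕ) : ℤ) • Q = d₁.derivedPoint) → Nat.card (AddCommGroup.primaryComponent (W.baseChange K).sha 2) ∣ 2 ^ (2 * M₀))
    (hL : ∀ (W : WeierstrassCurve ℚ) [W.IsElliptic] [W.IsGloballyMinimal] [NeZero (W.conductorNorm ℤ)], ¬ W.HasCM → ∀ (K : Type) [Field K] [NumberField K], IsImaginaryQuadratic K → Odd (NumberField.discr K) → NumberField.discr K ≠ -3 → SatisfiesHeegnerHypothesis (W.conductorNorm ℤ) K → ¬ IsSquare ((NumberField.discr K : ℚ) * -|W.Δ|) → ¬ IsSquare ((NumberField.discr K : ℚ) * (-(2 * |W.Δ|))) → (∀ n : ℕ, 0 < n → W.HasSurjectiveModNGaloisRep ((2 : ℤ) ^ n)) → ∀ (Dt : ModularParametrizationData W (W.conductorNorm ℤ)) (β : ℤ) (ι : K →+* ℂ) (d₁ : KolyvaginHeegnerData Dt β ι 1), ¬ IsOfFinAddOrder d₁.derivedPoint → ∀ (M₀ : ℕ), (∃ Q : (W.baseChange (ringClassField K ι 1)).toAffine.Point, ((2 ^ M₀ : ℕ) : ℤ) • Q = d₁.derivedPoint)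 → ∀ (n : ℕ) (d : KolyvaginHeegnerData Dt β ι n), Squarefree n → (∀ ℓ ∈ n.primeFactors, Zhang2014.IsKolyvaginPrime (W.conductorNorm ℤ) W K 2 ℓ) → (¬ ∃ Q : (W.baseChange (ringClassField K ι n)).toAffine.Point, (2 : ℤ) • Q = d.derivedPoint) → 2 ^ (2 * M₀) ∣ Nat.card (AddCommGroup.primaryComponent (W.baseChange K).sha 2)) :
    KolyvaginExactAtTwo := by
  intro W _ _ _ hcm K _ _ hIQ hodd h3 hHe hsq1 hsq2 hρ Dt β ι d₁ hy M₀ hdiv hndiv n d hn hKoly hPn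
  exact Nat.dvd_antisymm (hU W hcm K hIQ hodd h3 hHe hsq1 hsq2 hρ Dt β ι d₁ hy M₀ hndiv)
    (hL W hcm K hIQ hodd h3 hHe hsq1 hsq2 hρ Dt β ι d₁ hy M₀ hdiv n d hn hKoly hPn)

end Summit.BirchSwinnertonDyer.BirchSwinnertonDyer.Theorems.GenusExact.KolyvaginExactAtTwoStubs
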